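import Summits.MatrixMultiplication.MatrixMultiplication.Theorems.ObstructionDescentTorusLaws
import Summits.MatrixMultiplication.MatrixMultiplication.Theorems.ObstructionDescentSeparateDegree

set_option linter.dupNamespace false

/-!
# Coordinate degree from a dead unit window — the top step of the cube law (decomp-mm · lens 3 · gen 15, part I)

Route `route-MatrixMultiplication-ObstructionDescent`, support for the aside `InvariantSaturation` (item
`stmt-MatrixMultiplication-32282`); companion of part H (`ObstructionDescentSeparateDegree`: a full-format weight vector whose
degree along ONE coordinate direction is `≤ δ` at every point vanishes on rank `≤ r` for `δ·r < deg`).  This part supplies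
the degree bound `δ = k − 1` from the vanishing of the UNIT WINDOW.

* **§1 Weight law (`wt_eq_of_mem_support`, `sliceSum_eq_of_mem_support`).**  A weight vector `f ∈ hwvSpace Λ d` is isobaric
  for the maximal torus with weight `Λ`: every monomial `x^μ` of `f` has the three marginals of `μ` equal to `Λ 0, Λ 1, Λ 2`
  (`Σ_{p : p₁ = i} μ_p = Λ 0 i`, …).  Proof: the torus substitution `x_p ↦ t_p·ξ_{p₁}η_{p₂}ζ_{p₃}` of `f` equals
  `f(t)·(ξ,η,ζ)^Λ` on the torus (Borel eigenvector property for diagonal matrices), hence identically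
  (`MvPolynomial.funext_set` on the box `(ℂ^×)^{3m}`), and its `w`-coefficient is the value of the isobaric component `f_w`
  (`ObstructionDescentTorusLaws.coeff_aeval_torus`). [cite: BurgisserIkenmeyer2011, §3.1] [cite: LandsbergGCT2017, §7.1 (p. 218)]
* **§2 Coordinate degree from a dead unit window (`coordDegree_of_unitWindow`).**  Let `f ∈ hwvSpace Λ d` with
  `Λ 0 a = Λ 1 b = Λ 2 c = k` and suppose `f` vanishes at every point `y⁰ + e_{abc}` where `y⁰` has no entry in the slices
  `a ⊗ * ⊗ *`, `* ⊗ b ⊗ *`, `* ⊗ * ⊗ c` («the unit window `(m−1,1)³` at the cell `(a,b,c)` is dead»).  Then through EVERY point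
  `y` the polynomial `u ↦ f(y + u·e_{abc})` has degree `≤ k − 1`.  Proof (monomials): by §1 every monomial has `μ_{abc} ≤ k`;
  those with `μ_{abc} = k` involve no other variable of the three slices, so their contribution is `(y_{abc} + u)^k · H(y⁰)`
  with `H(y⁰) = f(y⁰ + e_{abc}) = 0`; the others have `u`-degree `≤ k − 1`.
* **§3 The cube law (`evalT_eq_zero_of_unitWindow`)** = §2 + part H (`evalT_eq_zero_of_coordDegree_level`): a full-format
  level-`k` vector with a dead unit window vanishes at every tensor of rank `≤ r` for `(k−1)·r < k·m` — H18 of NODE-g15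
  (Strassen's `F₃ ∈ I(σ₄(3³))` without determinants; `H₅ ∈ I(σ₇(5³))` from the census datum `c₄₁ = 0`, answering Q14.4;
  `K₈ ∈ I(σ₁₁(8³))` from `k₇(3) = 0`).  The dead-window input itself (a Kronecker vanishing `k_{m−1}(k) = 0` or a census
  window constant `c_{m−1,1} = 0`) stays a hypothesis here.
[cite: BurgisserIkenmeyer2011, §3.1–3.2, §6.2] [cite: BurgisserIkenmeyer2017, §5 (5.2), Thm 5.3] [cite: LandsbergGCT2017, §7.1]
-/

open scoped BigOperators
open Finset

namespace Summit.MatrixMultiplication.MatrixMultiplication.Theorems.ObstructionCalculus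

open Literature.Computability.AlgebraicComplexity (actTensor actTensor_apply triad triad_apply tensorRank)
open Summit.MatrixMultiplication.MatrixMultiplication.Theorems.ObstructionDescentTorusLaws (WIdx cellWt wt isoComp
  coeff_isoComp coeff_aeval_torus eval_aeval_torus)

variable {m : ℕ}

/-! ### §1 The weight law: weight vectors are isobaric of weight `Λ` -/

section WeightLaw

/-- **Torus identity.**  For a weight vector `f` of type `Λ`, the torus substitution `x_p ↦ t_p·ξ_{p₁}η_{p₂}ζ_{p₃}` of `f`
is the single monomial `f(t)·(ξ,η,ζ)^Λ`. [cite: BurgisserIkenmeyer2011, §3.1] -/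
theorem aeval_torus_of_mem_hwvSpace {Λ : Fin 3 → Fin m → ℕ} {d : ℕ} {f : MvPolynomial (Idx m) ℂ}
    (hf : f ∈ hwvSpace Λ d) (t : Tensor ℂ m) :
    MvPolynomial.aeval (fun p : Idx m => MvPolynomial.monomial (cellWt p) (t p.1 p.2.1 p.2.2)) f =
      MvPolynomial.monomial (Finsupp.equivFunOnFinite.symm (Sum.elim (Λ 0) (Sum.elim (Λ 1) (Λ 2)))) (evalT t f) := by
  classical
  refine MvPolynomial.funext_set (fun _ => ({0} : Set ℂ)ᶜ) (fun _ => (Set.finite_singleton (0 : ℂ)).infinite_compl)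
    fun x hx => ?_
  have hx' : ∀ w, x w ≠ 0 := fun w => Set.mem_compl_singleton_iff.mp (Set.mem_univ_pi.mp hx w)
  rw [eval_aeval_torus, MvPolynomial.eval_monomial, Finsupp.prod_fintype _ _ fun _ => pow_zero _]
  have h := hf.2 (Matrix.diagonal fun a => x (Sum.inl a)) (Matrix.diagonal fun b => x (Sum.inr (Sum.inl b)))
    (Matrix.diagonal fun c => x (Sum.inr (Sum.inr c))) (diagonal_mem_borel fun a => hx' _)
    (diagonal_mem_borel fun b => hx' _) (diagonal_mem_borel fun c => hx' _) t
  rw [evalT] at h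
  rw [h, weightChar_diagonal, weightChar_diagonal, weightChar_diagonal, Fintype.prod_sum_type, Fintype.prod_sum_type]
  simp only [Finsupp.coe_equivFunOnFinite_symm, Sum.elim_inl, Sum.elim_inr, evalT]
  ring

/-- **Weight law.**  Every monomial of a weight vector of type `Λ` has torus weight `Λ` (its three marginals are
`Λ 0, Λ 1, Λ 2`). [cite: BurgisserIkenmeyer2011, §3.1] [cite: LandsbergGCT2017, §7.1 (p. 218)] -/
theorem wt_eq_of_mem_support {Λ : Fin 3 → Fin m → ℕ} {d : ℕ} {f : MvPolynomial (Idx m) ℂ}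
    (hf : f ∈ hwvSpace Λ d) {μ : Idx m →₀ ℕ} (hμ : μ ∈ f.support) :
    wt μ = Finsupp.equivFunOnFinite.symm (Sum.elim (Λ 0) (Sum.elim (Λ 1) (Λ 2))) := by
  classical
  by_contra hne
  have hzero : isoComp (wt μ) f = 0 := by
    refine MvPolynomial.funext fun x => ?_
    rw [map_zero]
    have h := coeff_aeval_torus (fun a b c => x (a, b, c)) f (wt μ)
    have h2 := aeval_torus_of_mem_hwvSpace hf (fun a b c => x (a, b, c))
    beta_reduce at h2
    rw [h2, MvPolynomial.coeff_monomial, if_neg (Ne.symm hne)] at h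
    simp only [Prod.mk.eta] at h
    rw [← MvPolynomial.aeval_eq_eval]
    exact h.symm
  have hc : f.coeff μ = 0 := by
    have h := coeff_isoComp (wt μ) f μ
    rw [if_pos rfl, hzero, MvPolynomial.coeff_zero] at h
    exact h.symm
  exact (MvPolynomial.mem_support_iff.mp hμ) hc

/-- The torus weight of an exponent, read off slot by slot: its value at a basis character is a marginal. [bookkeeping] -/
theorem wt_apply_eq_sliceSum (μ : Idx m →₀ ℕ) (w : WIdx (Fin m) (Fin m) (Fin m)) :
    wt μ w = ∑ p ∈ μ.support, if cellWt p w = 1 then μ p else 0 := by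
  classical
  rw [wt, Finsupp.sum_apply, Finsupp.sum]
  refine Finset.sum_congr rfl fun p _ => ?_
  rw [Finsupp.smul_apply, smul_eq_mul]
  have h01 : cellWt p w = 1 ∨ cellWt p w = 0 := by
    unfold cellWt
    rcases w with i | i | i <;> simp [Finsupp.single_apply] <;> tauto
  rcases h01 with h | h
  · rw [h, if_pos rfl, mul_one]
  · rw [h, mul_zero, if_neg zero_ne_one]

/-- Values of the cell weight at the three kinds of basis characters. [bookkeeping] -/
theorem cellWt_apply (p : Idx m) (i : Fin m) :
    (cellWt p (Sum.inl i) = if p.1 = i then 1 else 0) ∧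
      (cellWt p (Sum.inr (Sum.inl i)) = if p.2.1 = i then 1 else 0) ∧
        (cellWt p (Sum.inr (Sum.inr i)) = if p.2.2 = i then 1 else 0) := by
  classical
  unfold cellWt
  refine ⟨?_, ?_, ?_⟩ <;> simp [Finsupp.single_apply]

/-- **Weight law, marginal form.**  For a monomial `x^μ` of a weight vector of type `Λ`: `Σ_{p : p₁ = i} μ_p = Λ 0 i`,
`Σ_{p : p₂ = i} μ_p = Λ 1 i`, `Σ_{p : p₃ = i} μ_p = Λ 2 i`. [cite: BurgisserIkenmeyer2011, §3.1] -/
theorem sliceSum_eq_of_mem_support {Λ : Fin 3 → Fin m → ℕ} {d : ℕ} {f : MvPolynomial (Idx m) ℂ}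
    (hf : f ∈ hwvSpace Λ d) {μ : Idx m →₀ ℕ} (hμ : μ ∈ f.support) (i : Fin m) :
    (∑ p ∈ μ.support.filter (fun p => p.1 = i), μ p) = Λ 0 i ∧
      (∑ p ∈ μ.support.filter (fun p => p.2.1 = i), μ p) = Λ 1 i ∧
        (∑ p ∈ μ.support.filter (fun p => p.2.2 = i), μ p) = Λ 2 i := by
  classical
  have hw := wt_eq_of_mem_support hf hμ
  refine ⟨?_, ?_, ?_⟩
  · have h := wt_apply_eq_sliceSum μ (Sum.inl i)
    rw [hw, Finsupp.coe_equivFunOnFinite_symm, Sum.elim_inl] at h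
    rw [h, Finset.sum_filter]
    exact Finset.sum_congr rfl fun p _ => by rw [(cellWt_apply p i).1]; by_cases hp : p.1 = i <;> simp [hp]
  · have h := wt_apply_eq_sliceSum μ (Sum.inr (Sum.inl i))
    rw [hw, Finsupp.coe_equivFunOnFinite_symm, Sum.elim_inr, Sum.elim_inl] at h
    rw [h, Finset.sum_filter]
    exact Finset.sum_congr rfl fun p _ => by rw [(cellWt_apply p i).2.1]; by_cases hp : p.2.1 = i <;> simp [hp]
  · have h := wt_apply_eq_sliceSum μ (Sum.inr (Sum.inr i))
    rw [hw, Finsupp.coe_equivFunOnFinite_symm, Sum.elim_inr, Sum.elim_inr] at h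
    rw [h, Finset.sum_filter]
    exact Finset.sum_congr rfl fun p _ => by rw [(cellWt_apply p i).2.2]; by_cases hp : p.2.2 = i <;> simp [hp]

end WeightLaw

/-! ### §2 Coordinate degree from a dead unit window -/

section UnitWindow

/-- Entries of the coordinate tensor `e_{abc} = e_a ⊗ e_b ⊗ e_c`. [bookkeeping] -/
theorem triad_single_apply (a b c x y z : Fin m) :
    triad (Pi.single a (1 : ℂ)) (Pi.single b 1) (Pi.single c 1) x y z =
      if ((x, y, z) : Idx m) = (a, b, c) then 1 else 0 := by
  rw [triad_apply]
  simp only [Pi.single_apply, Prod.mk.injEq]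
  by_cases hx : x = a <;> by_cases hy : y = b <;> by_cases hz : z = c <;> simp [hx, hy, hz]

/-- In a slice filter of total `k`, two distinct cells of the support cannot both sit when one of them already carries
`k`: if `Σ_{q ∈ supp μ, P q} μ_q = k`, `P e`, `μ_e = k`, then no `p ≠ e` of the support satisfies `P`. [bookkeeping] -/
theorem not_mem_slice_of_top {μ : Idx m →₀ ℕ} {k : ℕ} (P : Idx m → Prop) [DecidablePred P] {e : Idx m}
    (hPe : P e) (hsum : (∑ q ∈ μ.support.filter P, μ q) = k) (hμe : μ e = k) {p : Idx m} (hp : p ∈ μ.support)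
    (hpe : p ≠ e) : ¬ P p := by
  classical
  intro hPp
  have hp0 : μ p ≠ 0 := Finsupp.mem_support_iff.mp hp
  by_cases he : e ∈ μ.support
  · have hsub : ({e, p} : Finset (Idx m)) ⊆ μ.support.filter P := by
      intro q hq
      rw [Finset.mem_insert, Finset.mem_singleton] at hq
      rw [Finset.mem_filter]
      rcases hq with rfl | rfl
      · exact ⟨he, hPe⟩
      · exact ⟨hp, hPp⟩
    have h2 : μ e + μ p ≤ ∑ q ∈ μ.support.filter P, μ q := by
      rw [← Finset.sum_pair hpe.symm]
      exact Finset.sum_le_sum_of_subset hsub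
    omega
  · have he0 : μ e = 0 := Finsupp.notMem_support_iff.mp he
    have h1 : μ p ≤ ∑ q ∈ μ.support.filter P, μ q :=
      Finset.single_le_sum (fun q _ => Nat.zero_le (μ q)) (Finset.mem_filter.mpr ⟨hp, hPp⟩)
    omega

/-- Consequences of the weight law at a cell `e = (a,b,c)` carrying weight `k` in each slot: `μ_e ≤ k`; if `μ_e = k`
then no other cell of `μ` meets a slice of `e`; if `μ_e ≠ k` some other cell of `μ` lies in the slice `a ⊗ * ⊗ *`.
[bookkeeping] -/
theorem exponent_at_cell {Λ : Fin 3 → Fin m → ℕ} {d k : ℕ} {f : MvPolynomial (Idx m) ℂ}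
    (hf : f ∈ hwvSpace Λ d) {a b c : Fin m} (ha : Λ 0 a = k) (hb : Λ 1 b = k) (hc : Λ 2 c = k)
    {μ : Idx m →₀ ℕ} (hμ : μ ∈ f.support) :
    μ (a, b, c) ≤ k ∧
      (μ (a, b, c) = k → ∀ p ∈ μ.support, p ≠ (a, b, c) → p.1 ≠ a ∧ p.2.1 ≠ b ∧ p.2.2 ≠ c) ∧
        (μ (a, b, c) ≠ k → ∃ p ∈ μ.support, p ≠ (a, b, c) ∧ p.1 = a) := by
  classical
  obtain ⟨hSa, -, -⟩ := sliceSum_eq_of_mem_support hf hμ a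
  obtain ⟨-, hSb, -⟩ := sliceSum_eq_of_mem_support hf hμ b
  obtain ⟨-, -, hSc⟩ := sliceSum_eq_of_mem_support hf hμ c
  rw [ha] at hSa
  rw [hb] at hSb
  rw [hc] at hSc
  refine ⟨?_, fun hk p hp hpe => ⟨?_, ?_, ?_⟩, fun hk => ?_⟩
  · by_cases he : ((a, b, c) : Idx m) ∈ μ.support
    · rw [← hSa]
      exact Finset.single_le_sum (fun q _ => Nat.zero_le (μ q)) (Finset.mem_filter.mpr ⟨he, rfl⟩)
    · rw [Finsupp.notMem_support_iff.mp he]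
      exact Nat.zero_le _
  · exact not_mem_slice_of_top (fun q : Idx m => q.1 = a) rfl hSa hk hp hpe
  · exact not_mem_slice_of_top (fun q : Idx m => q.2.1 = b) rfl hSb hk hp hpe
  · exact not_mem_slice_of_top (fun q : Idx m => q.2.2 = c) rfl hSc hk hp hpe
  · by_contra hne
    have hsub : μ.support.filter (fun q : Idx m => q.1 = a) ⊆ {((a, b, c) : Idx m)} := by
      intro q hq
      rw [Finset.mem_filter] at hq
      rw [Finset.mem_singleton]
      by_contra hqe
      exact hne ⟨q, hq.1, hqe, hq.2⟩
    rcases Finset.subset_singleton_iff.mp hsub with h0 | h1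
    · rw [h0, Finset.sum_empty] at hSa
      have he : ((a, b, c) : Idx m) ∉ μ.support := by
        intro he
        have : ((a, b, c) : Idx m) ∈ μ.support.filter (fun q : Idx m => q.1 = a) := Finset.mem_filter.mpr ⟨he, rfl⟩
        rw [h0] at this
        exact Finset.notMem_empty _ this
      rw [Finsupp.notMem_support_iff.mp he] at hk
      exact hk hSa
    · rw [h1, Finset.sum_singleton] at hSa
      exact hk hSa

/-- **Coordinate degree from a dead unit window (top step of the cube law).**  Let `f` be a weight vector of type `Λ`
with weight `k` at the cell `e = (a,b,c)` in each slot, vanishing at every point `y⁰ + e_{abc}` whose `y⁰` has no entry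
in the three slices through `e`.  Then through every point `y`, `u ↦ f(y + u·e_{abc})` is a polynomial of degree `≤ k − 1`.
[this node] -/
theorem coordDegree_of_unitWindow {Λ : Fin 3 → Fin m → ℕ} {d k : ℕ} {f : MvPolynomial (Idx m) ℂ}
    (hf : f ∈ hwvSpace Λ d) {a b c : Fin m} (ha : Λ 0 a = k) (hb : Λ 1 b = k) (hc : Λ 2 c = k)
    (hdead : ∀ y : Tensor ℂ m,
      evalT ((fun x y' z => if x = a ∨ y' = b ∨ z = c then 0 else y x y' z) +
        triad (Pi.single a 1) (Pi.single b 1) (Pi.single c 1)) f = 0)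
    (y : Tensor ℂ m) :
    ∃ Q : Polynomial ℂ, Q.natDegree ≤ k - 1 ∧
      ∀ u : ℂ, evalT (y + u • triad (Pi.single a 1) (Pi.single b 1) (Pi.single c 1)) f = Q.eval u := by
  classical
  set e : Idx m := (a, b, c) with he
  set yv : Idx m → ℂ := fun p => y p.1 p.2.1 p.2.2 with hyv
  set g : Idx m → Polynomial ℂ := fun p => Polynomial.C (yv p) + if p = e then Polynomial.X else 0 with hg
  have hge : ∀ p, p ≠ e → g p = Polynomial.C (yv p) := fun p hp => by rw [hg]; simp [hp]
  have hgee : g e = Polynomial.C (yv e) + Polynomial.X := by rw [hg]; simp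
  have hEC := fun {μ : Idx m →₀ ℕ} (hμ : μ ∈ f.support) => exponent_at_cell hf ha hb hc hμ
  refine ⟨MvPolynomial.aeval g f, ?_, fun u => ?_⟩
  · -- (1) the expansion of `f(y + u e)` as a sum over the monomials of `f`
    have hexp : MvPolynomial.aeval g f =
        ∑ μ ∈ f.support, Polynomial.C (f.coeff μ) * ∏ p ∈ μ.support, g p ^ μ p := by
      conv_lhs => rw [f.as_sum]
      rw [map_sum]
      refine Finset.sum_congr rfl fun μ _ => ?_
      rw [MvPolynomial.aeval_monomial, Polynomial.algebraMap_eq, Finsupp.prod]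
    -- (2) terms with `μ_e ≠ k` have degree `≤ k - 1`
    have hlow : ∀ μ ∈ f.support.filter (fun μ => μ e ≠ k),
        (Polynomial.C (f.coeff μ) * ∏ p ∈ μ.support, g p ^ μ p).natDegree ≤ k - 1 := by
      intro μ hμ
      rw [Finset.mem_filter] at hμ
      have hle : μ e ≤ k := (hEC hμ.1).1
      refine (Polynomial.natDegree_C_mul_le _ _).trans ((Polynomial.natDegree_prod_le _ _).trans ?_)
      have hdeg : ∀ p ∈ μ.support, (g p ^ μ p).natDegree ≤ if p = e then μ e else 0 := by
        intro p _
        by_cases hp : p = e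
        · rw [if_pos hp, hp, hgee]
          refine Polynomial.natDegree_pow_le.trans ?_
          have h1 : (Polynomial.C (yv e) + Polynomial.X).natDegree ≤ 1 :=
            (Polynomial.natDegree_add_le _ _).trans
              (max_le ((Polynomial.natDegree_C _).le.trans zero_le_one) Polynomial.natDegree_X_le)
          calc μ e * (Polynomial.C (yv e) + Polynomial.X).natDegree ≤ μ e * 1 := Nat.mul_le_mul_left _ h1
            _ = μ e := mul_one _
        · rw [if_neg hp, hge p hp, ← map_pow, Polynomial.natDegree_C]
      refine (Finset.sum_le_sum hdeg).trans ?_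
      rw [Finset.sum_ite_eq' μ.support e]
      split_ifs
      · omega
      · exact Nat.zero_le _
    -- (3) the top terms, `μ_e = k`, sum to `(y_e + X)^k · H` with `H = f(y⁰ + e_{abc}) = 0`
    have htopterm : ∀ μ ∈ f.support.filter (fun μ => μ e = k),
        Polynomial.C (f.coeff μ) * ∏ p ∈ μ.support, g p ^ μ p =
          (Polynomial.C (yv e) + Polynomial.X) ^ k *
            Polynomial.C (f.coeff μ * ∏ p ∈ μ.support.filter (fun p => p ≠ e), yv p ^ μ p) := by
      intro μ hμ
      rw [Finset.mem_filter] at hμ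
      have hprod : ∏ p ∈ μ.support, g p ^ μ p =
          ∏ p ∈ μ.support, (if p = e then (Polynomial.C (yv e) + Polynomial.X) ^ k
            else Polynomial.C (yv p ^ μ p)) := by
        refine Finset.prod_congr rfl fun p _ => ?_
        by_cases hp : p = e
        · rw [if_pos hp, hp, hgee, hμ.2]
        · rw [if_neg hp, hge p hp, map_pow]
      rw [hprod, Finset.prod_ite, Finset.prod_const, Finset.filter_eq' μ.support e, map_mul, map_prod]
      by_cases hmem : e ∈ μ.support
      · rw [if_pos hmem, Finset.card_singleton, pow_one]
        ring
      · rw [if_neg hmem, Finset.card_empty, pow_zero, one_mul]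
        have hk0 : k = 0 := by rw [← hμ.2]; exact Finsupp.notMem_support_iff.mp hmem
        rw [hk0, pow_zero, one_mul]
    have hH : ∑ μ ∈ f.support.filter (fun μ => μ e = k),
        f.coeff μ * ∏ p ∈ μ.support.filter (fun p => p ≠ e), yv p ^ μ p = 0 := by
      have h0 := hdead y
      rw [evalT, MvPolynomial.aeval_eq_eval, MvPolynomial.eval_eq,
        ← Finset.sum_filter_add_sum_filter_not f.support (fun μ => μ e = k)] at h0
      set z : Idx m → ℂ := fun p => ((fun x y' z => if x = a ∨ y' = b ∨ z = c then (0 : ℂ) else y x y' z) +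
        triad (Pi.single a (1 : ℂ)) (Pi.single b 1) (Pi.single c 1)) p.1 p.2.1 p.2.2 with hz
      have hzp : ∀ p : Idx m, z p = (if p.1 = a ∨ p.2.1 = b ∨ p.2.2 = c then (0 : ℂ) else yv p) +
          if p = e then 1 else 0 := by
        intro p
        rw [hz, he]
        simp only [Pi.add_apply, triad_single_apply, Prod.mk.eta, hyv]
      have hnot : ∑ μ ∈ f.support.filter (fun μ => ¬μ e = k), f.coeff μ * ∏ p ∈ μ.support, z p ^ μ p = 0 := by
        refine Finset.sum_eq_zero fun μ hμ => ?_
        rw [Finset.mem_filter] at hμ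
        obtain ⟨p, hp, hpe, hpa⟩ := (hEC hμ.1).2.2 hμ.2
        have hz0 : z p = 0 := by rw [hzp p, if_pos (Or.inl hpa), if_neg hpe, add_zero]
        rw [Finset.prod_eq_zero hp (by rw [hz0, zero_pow (Finsupp.mem_support_iff.mp hp)]), mul_zero]
      have hyes : ∀ μ ∈ f.support.filter (fun μ => μ e = k), f.coeff μ * ∏ p ∈ μ.support, z p ^ μ p =
          f.coeff μ * ∏ p ∈ μ.support.filter (fun p => p ≠ e), yv p ^ μ p := by
        intro μ hμ
        rw [Finset.mem_filter] at hμ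
        have hzz : ∀ p ∈ μ.support, z p ^ μ p = if p ≠ e then yv p ^ μ p else 1 := by
          intro p hp
          by_cases hpe : p = e
          · rw [if_neg (not_not.mpr hpe), hzp p, if_pos hpe, hpe, he]
            simp
          · obtain ⟨h1, h2, h3⟩ := (hEC hμ.1).2.1 hμ.2 p hp hpe
            rw [if_pos hpe, hzp p, if_neg hpe, if_neg (not_or.mpr ⟨h1, not_or.mpr ⟨h2, h3⟩⟩), add_zero]
        rw [Finset.prod_congr rfl hzz, Finset.prod_ite, Finset.prod_const_one, mul_one]
      rw [hnot, add_zero, Finset.sum_congr rfl hyes] at h0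
      exact h0
    have htop : ∑ μ ∈ f.support.filter (fun μ => μ e = k),
        Polynomial.C (f.coeff μ) * ∏ p ∈ μ.support, g p ^ μ p = 0 := by
      rw [Finset.sum_congr rfl htopterm, ← Finset.mul_sum, ← map_sum, hH, map_zero, mul_zero]
    rw [hexp, ← Finset.sum_filter_add_sum_filter_not f.support (fun μ => μ e = k), htop, zero_add]
    exact Polynomial.natDegree_sum_le_of_forall_le _ _ hlow
  · -- evaluation at `u`
    rw [← Polynomial.coe_aeval_eq_eval, MvPolynomial.comp_aeval_apply, evalT]
    have hfun : (fun p : Idx m => (Polynomial.aeval u) (g p)) =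
        fun p : Idx m => (y + u • triad (Pi.single a (1 : ℂ)) (Pi.single b 1) (Pi.single c 1)) p.1 p.2.1 p.2.2 := by
      funext p
      rw [hg, he]
      simp only [map_add, Polynomial.aeval_C, Algebra.algebraMap_self_apply, apply_ite (Polynomial.aeval u),
        Polynomial.aeval_X, map_zero, Pi.add_apply, Pi.smul_apply, smul_eq_mul, triad_single_apply, Prod.mk.eta, hyv]
      split_ifs <;> ring
    rw [hfun]

/-- The full-format rectangular type `((k^m))³` carries weight `k` at every index of every slot. [bookkeeping] -/
theorem rectType_self_apply (k : ℕ) (s : Fin 3) (i : Fin m) : rectType m m k s i = k := by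
  simp only [rectType, if_pos (Nat.le_add_left m i)]

/-- **CUBE LAW (kernel form; H18 of NODE-g15).**  A level-`k` vector `f` of the full format `m` (type `((k^m))³`,
degree `k·m`) whose unit window at some cell `(a,b,c)` is dead — `f(y⁰ + e_{abc}) = 0` for every `y⁰` supported off
the three slices through `(a,b,c)` — vanishes at every tensor of rank `≤ r` as soon as `(k−1)·r < k·m`.
Instances (with census data as the dead-window input): Strassen's `F₃ ∈ I(σ₄(3³))` (`k₂(3) = 0`), `H₅ ∈ I(σ₇(5³))`
(`c₄₁ = 0`), `K₈ ∈ I(σ₁₁(8³))` (`k₇(3) = 0`). [this node] [cite: BurgisserIkenmeyer2011, §6.2] -/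
theorem evalT_eq_zero_of_unitWindow {k : ℕ} {f : MvPolynomial (Idx m) ℂ}
    (hf : f ∈ hwvSpace (rectType m m k) (k * m)) {a b c : Fin m}
    (hdead : ∀ y : Tensor ℂ m,
      evalT ((fun x y' z => if x = a ∨ y' = b ∨ z = c then 0 else y x y' z) +
        triad (Pi.single a 1) (Pi.single b 1) (Pi.single c 1)) f = 0)
    {r : ℕ} (hr : (k - 1) * r < k * m) {t : Tensor ℂ m} (ht : tensorRank t ≤ r) : evalT t f = 0 :=
  evalT_eq_zero_of_coordDegree_level hf
    (coordDegree_of_unitWindow hf (rectType_self_apply k 0 a) (rectType_self_apply k 1 b) (rectType_self_apply k 2 c)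
      hdead) hr ht

end UnitWindow

end Summit.MatrixMultiplication.MatrixMultiplication.Theorems.ObstructionCalculus
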